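import Literature.RingTheory.KTheory.MilnorKNilpotent
import HarnessLib

/-!
# `k_nF = K_nF/2K_nF`: the graded `ℤ/2`-algebra `k_*F`, `k₁F ≅ F•/F•²`, and the rank-2 computation behind the
# Stiefel–Whitney invariants (Milnor, *Algebraic K-theory and quadratic forms*, Invent. Math. 9 (1970), §3)

Family `hodge`, lane `lit-hodgefound` (foundations library; seat `lit-hodgefound-p27`, generation 40, row g40-#9);
topic `RingTheory/KTheory`.  Sequel of `MilnorKGroups` (g39-#12: `K_nR = MilnorK R n`, `symbol`, `hom_ext`,
`symbol_update_mul/inv/zpow`, the `K₂` identities `symbol_vec2_*`, `zeroEquiv : K₀R ≃ ℤ`, `oneEquiv : K₁R ≃ R•`),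
`MilnorKRing` (g39-#14: the products `mul R m n`, `mul_symbol_symbol`, LEMMA 1.1 `symbol_append_comm`, `castEquiv`) and
`MilnorKNilpotent` (g40-#6: LEMMA 1.2 at two slots, `symbol_eq_update_neg_one_of_eq`).  DEFINITIONS WITH BODIES
(`twoMultiples`, the `abbrev Mod2`, `kmk`, `kSymbol`, `kCast`, `kMulLeft`, `kMulHom`, `kMul`, `kZeroEquiv`, `kOneEquiv`,
`kpair`) and PROVED THEOREMS; no named fact, no instance (the group structure of `k_nR` is Mathlib's quotient-group
structure, reached through the `abbrev`), no notation, 0 `sorry`, net debt 0 (D-0026).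

## The source, verbatim

J. Milnor, *Algebraic K-theory and quadratic forms*, Invent. Math. 9 (1970) 318–344 (held `paper:doi-10-1007-bf01425486`;
bib key `Milnor1970`), §3 (p0010 L27–L32): «For the rest of this paper we will only be interested in the quotient of
the ring K_*F by the ideal 2K_*F. To simplify the notation, let us set k_nF = K_nF/2K_nF. Thus k_*F is a graded
algebra over Z/2Z, with k₁F ≅ F•/F•². We will always assume that F has characteristic ≠ 2.»  And the proof of
LEMMA 3.1 («The invariant w(M) is a well defined unit in the ring k_ΠF and satisfies the Whitney sum formula
w(M ⊕ N) = w(M)w(N)»), p0011 L33 – p0012 L6: «Just as in the classical proof that the Hasse-Witt invariant is well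
defined, it suffices to consider the rank 2 case. […] Suppose then that (a) ⊕ (b) ≅ (α), (β). Then the discriminant
ab must be equal to αβ multiplied by a square; or in other words (4) l(a) + l(b) ≡ l(α) + l(β) mod 2K₁F.
Furthermore, the equation α = a x² + b y² must have a solution x, y ∈ F. Since the case x = 0 or y = 0 is easily
disposed of, we may assume that x ≠ 0, y ≠ 0. Then the equation 1 = a x²/α + b y²/α implies that
0 = (l(a) + 2l(x) − l(α))(l(b) + 2l(y) − l(α)) ≡ (l(a) − l(α))(l(b) − l(α)) mod 2K₂F. Rearranging terms, and then
substituting (4) this implies that l(a)l(b) ≡ −l(α)(l(a) + l(b) − l(α)) ≡ l(α)l(β) mod 2K₂F; which completes the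
proof.»

## What is formalised

* §1 **`k_nR = K_nR/2K_nR`** for a commutative ring `R`: `twoMultiples R n = 2K_nR`, `Mod2 R n`, the projection `kmk`,
  `add_self_eq_zero : x + x = 0` (`k_nR` is an `𝔽₂`-vector space), the classes of symbols `kSymbol a = {a₁, …, aₙ}` with
  multilinearity and the Steinberg relation, **`kSymbol_update_inv`** and **`kSymbol_update_mul_sq`** (inverses and
  squares are invisible mod `2`), `mod2_hom_ext`.
* §2 **the graded algebra**: the products **`kMul R m n : k_mR →+ k_nR →+ k_{m+n}R`** induced by the products of
  `K_*R` (`MilnorK.mul`), `kMul_kSymbol : {a}·{b} = {a, b}`, the degree casts `kCast`; **`kZeroEquiv : k₀R ≃+ ℤ/2ℤ`**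
  and **`kOneEquiv : k₁R ≃+ Additive Rˣ ⧸ 2`** («k₁F ≅ F•/F•²»: `mem_range_two_zsmul_iff` identifies `2·(R•)` with the
  squares).
* §3 over a field: **`kSymbol_append_comm`** (LEMMA 1.1 mod `2`: `{b, a} = {a, b}`, the sign `(−1)^{mn}` dies) and
  **`kMul_comm`** (`k_*F` is commutative); **`kSymbol_eq_update_neg_one_of_eq`** (LEMMA 1.2 mod `2`); in `k₂F` the
  symbols `kpair a b = {a, b}` with bilinearity, Steinberg, `kpair_comm`, `kpair_self : {a, a} = {a, −1}`,
  `kpair_neg_self : {a, −a} = 0`, invisibility of squares and inverses; and **the rank-`2` computation of LEMMA 3.1**: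
  **`kpair_eq_of_eq_add_sq : α = a x² + b y² (a unit) ⇒ {a, b} = {α, abα}` in `k₂F`** together with
  `kSymbol_add_eq_of_eq_add_sq : l(a) + l(b) = l(α) + l(abα)` in `k₁F` — the Stiefel–Whitney invariants `w₁, w₂` of the
  isometric binary forms `⟨a⟩ ⊕ ⟨b⟩ ≅ ⟨α⟩ ⊕ ⟨abα⟩` agree.

Not here: quadratic modules, the algebra `k_ΠF` of formal series and `w(M)` itself (LEMMA 3.1 needs Witt's chain
equivalence); the `ℤ/2`-module structure of `k_nR` is expressed by `add_self_eq_zero` rather than a `Module (ZMod 2)`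
instance.

## References

* [Milnor1970] J. Milnor, *Algebraic K-theory and quadratic forms*, Invent. Math. 9 (1970) 318–344 — §3, the algebra
  `k_*F` (p0010 L27–L32), Lemma 3.1 and its proof (p0011 L24 – p0012 L6); §1 Lemmas 1.1, 1.2 (p0002 L33–L50).

Provenance: lane `lit-hodgefound`, seat `lit-hodgefound-p27` gen 40 (agent `literature-prover-lit-hodgefound-p27-g40-0`),
row g40-#9.
-/

set_option autoImplicit false

noncomputable section

namespace Literature.RingTheory.KTheory

namespace MilnorK

open Function

section Ring

variable (R : Type*) [CommRing R] (n : ℕ)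

/-- `2K_nR ⊆ K_nR`, the image of multiplication by `2`. [cite: Milnor1970, §3 «k_nF = K_nF/2K_nF» (p0010 L27–L30)] -/
def twoMultiples : AddSubgroup (MilnorK R n) := (zsmulAddGroupHom (α := MilnorK R n) 2).range

/-- Membership in `2K_nR`. [cite: Milnor1970, §3 «k_nF = K_nF/2K_nF» (p0010 L27–L30)] -/
theorem mem_twoMultiples_iff {x : MilnorK R n} : x ∈ twoMultiples R n ↔ ∃ y : MilnorK R n, (2 : ℤ) • y = x := by
  simp only [twoMultiples, AddMonoidHom.mem_range, zsmulAddGroupHom_apply]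

/-- `2x ∈ 2K_nR`. [cite: Milnor1970, §3 «k_nF = K_nF/2K_nF» (p0010 L27–L30)] -/
theorem two_zsmul_mem_twoMultiples (x : MilnorK R n) : (2 : ℤ) • x ∈ twoMultiples R n :=
  (mem_twoMultiples_iff R n).2 ⟨x, rfl⟩

/-- **`k_nR = K_nR / 2K_nR`** («let us set k_nF = K_nF/2K_nF»), as a quotient group (an `abbrev`: Mathlib's quotient-group
structure applies, no instance is declared). [cite: Milnor1970, §3 «k_nF = K_nF/2K_nF» (p0010 L27–L30)] -/
abbrev Mod2 : Type _ := MilnorK R n ⧸ twoMultiples R n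

/-- The projection `K_nR → k_nR`. [cite: Milnor1970, §3 «k_nF = K_nF/2K_nF» (p0010 L27–L30)] -/
def kmk : MilnorK R n →+ Mod2 R n := QuotientAddGroup.mk' (twoMultiples R n)

variable {R n}

/-- `kmk` is the quotient map. [cite: Milnor1970, §3 «k_nF = K_nF/2K_nF» (p0010 L27–L30)] -/
theorem kmk_apply (x : MilnorK R n) : kmk R n x = (x : Mod2 R n) := rfl

/-- `K_nR → k_nR` is onto. [cite: Milnor1970, §3 «k_nF = K_nF/2K_nF» (p0010 L27–L30)] -/
theorem kmk_surjective : Function.Surjective (kmk R n) := QuotientAddGroup.mk'_surjective _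

/-- `2x ↦ 0`. [cite: Milnor1970, §3 «k_nF = K_nF/2K_nF» (p0010 L27–L30)] -/
theorem kmk_two_zsmul (x : MilnorK R n) : kmk R n ((2 : ℤ) • x) = 0 :=
  (QuotientAddGroup.eq_zero_iff _).2 (two_zsmul_mem_twoMultiples R n x)

/-- The kernel of `K_nR → k_nR` is `2K_nR`. [cite: Milnor1970, §3 «k_nF = K_nF/2K_nF» (p0010 L27–L30)] -/
theorem kmk_eq_zero_iff {x : MilnorK R n} : kmk R n x = 0 ↔ ∃ y : MilnorK R n, (2 : ℤ) • y = x := by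
  rw [kmk, QuotientAddGroup.mk'_apply, QuotientAddGroup.eq_zero_iff, mem_twoMultiples_iff]

/-- **`k_nR` is a vector space over `ℤ/2ℤ`**: `x + x = 0` («a graded algebra over Z/2Z»). [cite: Milnor1970, §3 «Thus k_*F is a graded algebra over Z/2Z» (p0010 L30–L31)] -/
theorem add_self_eq_zero (x : Mod2 R n) : x + x = 0 := by
  obtain ⟨y, rfl⟩ := kmk_surjective x
  rw [← map_add, ← two_zsmul]
  exact kmk_two_zsmul y

/-- `−x = x` in `k_nR`. [cite: Milnor1970, §3 «Thus k_*F is a graded algebra over Z/2Z» (p0010 L30–L31)] -/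
theorem neg_eq_self' (x : Mod2 R n) : -x = x :=
  neg_eq_of_add_eq_zero_left (add_self_eq_zero x)

/-- `x − y = x + y` in `k_nR`. [cite: Milnor1970, §3 «Thus k_*F is a graded algebra over Z/2Z» (p0010 L30–L31)] -/
theorem sub_eq_add' (x y : Mod2 R n) : x - y = x + y := by rw [sub_eq_add_neg, neg_eq_self']

/-- Even multiples vanish in `k_nR`. [cite: Milnor1970, §3 «Thus k_*F is a graded algebra over Z/2Z» (p0010 L30–L31)] -/
theorem kmk_zsmul_even {k : ℤ} (hk : Even k) (x : MilnorK R n) : kmk R n (k • x) = 0 := by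
  obtain ⟨j, rfl⟩ := hk
  rw [add_zsmul, map_add]; exact add_self_eq_zero _

/-- Additive maps out of `k_nR` agreeing on the classes of symbols agree. [cite: Milnor1970, §3 «k_nF = K_nF/2K_nF» (p0010 L27–L30)] -/
theorem mod2_hom_ext {A : Type*} [AddCommGroup A] {f g : Mod2 R n →+ A}
    (h : ∀ a : Fin n → Rˣ, f (kmk R n (symbol a)) = g (kmk R n (symbol a))) : f = g :=
  QuotientAddGroup.addMonoidHom_ext _ (hom_ext h)

/-- The class `{a₁, …, aₙ} ∈ k_nR` of the symbol `l(a₁)⋯l(aₙ)`. [cite: Milnor1970, §3 «k_nF = K_nF/2K_nF» (p0010 L27–L30)] -/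
def kSymbol (a : Fin n → Rˣ) : Mod2 R n := kmk R n (symbol a)

/-- `kSymbol` unfolded. [cite: Milnor1970, §3 «k_nF = K_nF/2K_nF» (p0010 L27–L30)] -/
theorem kSymbol_def (a : Fin n → Rˣ) : kSymbol a = kmk R n (symbol a) := rfl

/-- Multilinearity of `{…}` in `k_nR`. [cite: Milnor1970, §3 «k_nF = K_nF/2K_nF» (p0010 L27–L30)] -/
theorem kSymbol_update_mul (a : Fin n → Rˣ) (i : Fin n) (x y : Rˣ) :
    kSymbol (update a i (x * y)) = kSymbol (update a i x) + kSymbol (update a i y) := by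
  rw [kSymbol, symbol_update_mul, map_add]; rfl

/-- A symbol with an entry `1` vanishes. [cite: Milnor1970, §3 «k_nF = K_nF/2K_nF» (p0010 L27–L30)] -/
theorem kSymbol_eq_zero_of_eq_one (a : Fin n → Rˣ) (i : Fin n) (h : a i = 1) : kSymbol a = 0 := by
  rw [kSymbol, symbol_eq_zero_of_eq_one a i h, map_zero]

/-- The Steinberg relation in `k_nR`. [cite: Milnor1970, §3 «k_nF = K_nF/2K_nF» (p0010 L27–L30)] -/
theorem kSymbol_eq_zero_of_add_eq_one (a : Fin n → Rˣ) (i : Fin n) (h : i.val + 1 < n)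
    (hsum : (a i : R) + a (finSucc i h) = 1) : kSymbol a = 0 := by
  rw [kSymbol, symbol_eq_zero_of_add_eq_one a i h hsum, map_zero]

/-- **Inverses are invisible mod `2`**: `{…, x⁻¹, …} = {…, x, …}` in `k_nR` (`l(x⁻¹) = −l(x) ≡ l(x)`). [cite: Milnor1970, §3 «with k₁F ≅ F•/F•²» (p0010 L31)] -/
theorem kSymbol_update_inv (a : Fin n → Rˣ) (i : Fin n) (x : Rˣ) :
    kSymbol (update a i x⁻¹) = kSymbol (update a i x) := by
  rw [kSymbol, symbol_update_inv, map_neg, kSymbol_def, neg_eq_self']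

/-- **Squares are invisible mod `2`**: `{…, x y², …} = {…, x, …}` in `k_nR` (`l(y²) = 2l(y) ≡ 0`; «ab must be equal to
αβ multiplied by a square»). [cite: Milnor1970, §3 «with k₁F ≅ F•/F•²» (p0010 L31)] -/
theorem kSymbol_update_mul_sq (a : Fin n → Rˣ) (i : Fin n) (x y : Rˣ) :
    kSymbol (update a i (x * y ^ 2)) = kSymbol (update a i x) := by
  rw [kSymbol_update_mul, kSymbol_def (update a i (y ^ 2)), ← zpow_natCast, symbol_update_zpow, Nat.cast_ofNat,
    kmk_two_zsmul, add_zero]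

/-- A symbol with a square entry vanishes in `k_nR`. [cite: Milnor1970, §3 «with k₁F ≅ F•/F•²» (p0010 L31)] -/
theorem kSymbol_update_sq (a : Fin n → Rˣ) (i : Fin n) (y : Rˣ) : kSymbol (update a i (y ^ 2)) = 0 := by
  rw [← _root_.one_mul (y ^ 2), kSymbol_update_mul_sq]
  exact kSymbol_eq_zero_of_eq_one _ i (by simp)

/-! ### the products `k_m × k_n → k_{m+n}` and the degree casts -/

/-- The degree identification `k_pR = k_qR` for `p = q`. [cite: Milnor1970, §3 «Thus k_*F is a graded algebra over Z/2Z» (p0010 L30–L31)] -/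
def kCast {p q : ℕ} (h : p = q) : Mod2 R p ≃+ Mod2 R q := by subst h; exact AddEquiv.refl _

/-- `kCast rfl = id`. [cite: Milnor1970, §3 «Thus k_*F is a graded algebra over Z/2Z» (p0010 L30–L31)] -/
theorem kCast_rfl {p : ℕ} (x : Mod2 R p) : kCast rfl x = x := rfl

/-- `kCast` is induced by `castEquiv` of `MilnorKRing`. [cite: Milnor1970, §3 «Thus k_*F is a graded algebra over Z/2Z» (p0010 L30–L31)] -/
theorem kCast_kmk {p q : ℕ} (h : p = q) (x : MilnorK R p) : kCast h (kmk R p x) = kmk R q (castEquiv h x) := by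
  subst h; rfl

variable (R) in
/-- Left multiplication by a fixed `x ∈ K_mR`, `k_nR → k_{m+n}R` (the product of `K_*R` kills `2K_nR` into `2K_{m+n}R`).
[cite: Milnor1970, §3 «Thus k_*F is a graded algebra over Z/2Z» (p0010 L30–L31)] -/
def kMulLeft (m n : ℕ) (x : MilnorK R m) : Mod2 R n →+ Mod2 R (m + n) :=
  QuotientAddGroup.lift (twoMultiples R n) ((kmk R (m + n)).comp (mul R m n x)) (by
    rintro y ⟨z, rfl⟩
    rw [AddMonoidHom.mem_ker, AddMonoidHom.comp_apply, zsmulAddGroupHom_apply, map_zsmul]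
    exact kmk_two_zsmul _)

/-- `kMulLeft x` on classes. [cite: Milnor1970, §3 «Thus k_*F is a graded algebra over Z/2Z» (p0010 L30–L31)] -/
theorem kMulLeft_kmk {m n : ℕ} (x : MilnorK R m) (y : MilnorK R n) :
    kMulLeft R m n x (kmk R n y) = kmk R (m + n) (mul R m n x y) :=
  QuotientAddGroup.lift_mk _ _ y

variable (R) in
/-- `x ↦ kMulLeft x` is additive in `x ∈ K_mR`. [cite: Milnor1970, §3 «Thus k_*F is a graded algebra over Z/2Z» (p0010 L30–L31)] -/
def kMulHom (m n : ℕ) : MilnorK R m →+ (Mod2 R n →+ Mod2 R (m + n)) :=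
  AddMonoidHom.mk' (kMulLeft R m n) fun x x' => QuotientAddGroup.addMonoidHom_ext _ (AddMonoidHom.ext fun y => by
    change kMulLeft R m n (x + x') (kmk R n y) = kMulLeft R m n x (kmk R n y) + kMulLeft R m n x' (kmk R n y)
    rw [kMulLeft_kmk, kMulLeft_kmk, kMulLeft_kmk, map_add, AddMonoidHom.add_apply, map_add])

variable (R) in
/-- **The product `k_mR × k_nR → k_{m+n}R` of the graded algebra `k_*R = K_*R/2K_*R`**, induced by the product
`K_mR × K_nR → K_{m+n}R` («the quotient of the ring K_*F by the ideal 2K_*F»). [cite: Milnor1970, §3 «Thus k_*F is a graded algebra over Z/2Z» (p0010 L30–L31)] -/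
def kMul (m n : ℕ) : Mod2 R m →+ Mod2 R n →+ Mod2 R (m + n) :=
  QuotientAddGroup.lift (twoMultiples R m) (kMulHom R m n) (by
    rintro x ⟨z, rfl⟩
    rw [AddMonoidHom.mem_ker]
    refine QuotientAddGroup.addMonoidHom_ext _ (AddMonoidHom.ext fun y => ?_)
    change kMulLeft R m n (zsmulAddGroupHom 2 z) (kmk R n y) = 0
    rw [kMulLeft_kmk, zsmulAddGroupHom_apply]
    have : mul R m n ((2 : ℤ) • z) y = (mul R m n).flip y ((2 : ℤ) • z) := rfl
    rw [this, map_zsmul]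
    exact kmk_two_zsmul _)

/-- `kMul` on classes is the class of the product. [cite: Milnor1970, §3 «Thus k_*F is a graded algebra over Z/2Z» (p0010 L30–L31)] -/
theorem kMul_kmk_kmk {m n : ℕ} (x : MilnorK R m) (y : MilnorK R n) :
    kMul R m n (kmk R m x) (kmk R n y) = kmk R (m + n) (mul R m n x y) := by
  change kMulHom R m n x (kmk R n y) = _
  exact kMulLeft_kmk x y

/-- **`{a}·{b} = {a, b}`** in `k_*R`. [cite: Milnor1970, §3 «Thus k_*F is a graded algebra over Z/2Z» (p0010 L30–L31)] -/
theorem kMul_kSymbol {m n : ℕ} (a : Fin m → Rˣ) (b : Fin n → Rˣ) :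
    kMul R m n (kSymbol a) (kSymbol b) = kSymbol (Fin.append a b) := by
  rw [kSymbol, kSymbol, kMul_kmk_kmk, mul_symbol_symbol]; rfl

/-- Biadditive maps out of `k_mR × k_nR` agreeing on classes of symbols agree. [cite: Milnor1970, §3 «Thus k_*F is a graded algebra over Z/2Z» (p0010 L30–L31)] -/
theorem mod2_hom_ext₂ {m n : ℕ} {A : Type*} [AddCommGroup A] {f g : Mod2 R m →+ Mod2 R n →+ A}
    (h : ∀ (a : Fin m → Rˣ) (b : Fin n → Rˣ), f (kSymbol a) (kSymbol b) = g (kSymbol a) (kSymbol b)) : f = g :=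
  mod2_hom_ext fun a => mod2_hom_ext fun b => h a b

/-! ### `k₀R = ℤ/2ℤ` and `k₁R = R•/R•²` -/

/-- Under `K₀R = ℤ`, `2K₀R = 2ℤ`. [cite: Milnor1970, §3 «k_nF = K_nF/2K_nF» (p0010 L27–L30)] -/
theorem map_zeroEquiv_twoMultiples :
    (twoMultiples R 0).map (zeroEquiv R : MilnorK R 0 →+ ℤ) = AddSubgroup.zmultiples (2 : ℤ) := by
  ext x
  constructor
  · rintro ⟨y, ⟨z, rfl⟩, rfl⟩
    rw [AddMonoidHom.coe_coe, zsmulAddGroupHom_apply, map_zsmul, smul_eq_mul, mul_comm]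
    exact AddSubgroup.mem_zmultiples_iff.2 ⟨zeroEquiv R z, smul_eq_mul _ _⟩
  · intro hx
    obtain ⟨k, rfl⟩ := AddSubgroup.mem_zmultiples_iff.1 hx
    refine ⟨(2 : ℤ) • (zeroEquiv R).symm k, two_zsmul_mem_twoMultiples R 0 _, ?_⟩
    rw [AddMonoidHom.coe_coe, map_zsmul, AddEquiv.apply_symm_apply, smul_eq_mul, smul_eq_mul, mul_comm]

variable (R) in
/-- **`k₀R ≅ ℤ/2ℤ`.** [cite: Milnor1970, §3 «Thus k_*F is a graded algebra over Z/2Z» (p0010 L30–L31)] -/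
def kZeroEquiv : Mod2 R 0 ≃+ ℤ ⧸ AddSubgroup.zmultiples (2 : ℤ) :=
  QuotientAddGroup.congr (twoMultiples R 0) _ (zeroEquiv R) map_zeroEquiv_twoMultiples

/-- In `R•` written additively, `2·(R•)` is the group of squares. [cite: Milnor1970, §3 «with k₁F ≅ F•/F•²» (p0010 L31)] -/
theorem mem_range_two_zsmul_iff (x : Additive Rˣ) :
    x ∈ (zsmulAddGroupHom (α := Additive Rˣ) 2).range ↔ ∃ u : Rˣ, u ^ 2 = Additive.toMul x := by
  constructor
  · rintro ⟨y, rfl⟩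
    exact ⟨Additive.toMul y, rfl⟩
  · rintro ⟨u, hu⟩
    exact ⟨Additive.ofMul u, by rw [zsmulAddGroupHom_apply]; exact hu⟩

/-- Under `K₁R = R•` (additively), `2K₁R` is `2·(R•)`, the squares. [cite: Milnor1970, §3 «with k₁F ≅ F•/F•²» (p0010 L31)] -/
theorem map_oneEquiv_twoMultiples :
    (twoMultiples R 1).map (oneEquiv R : MilnorK R 1 →+ Additive Rˣ) = (zsmulAddGroupHom (α := Additive Rˣ) 2).range := by
  ext x
  constructor
  · rintro ⟨y, ⟨z, rfl⟩, rfl⟩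
    exact ⟨oneEquiv R z, by rw [AddMonoidHom.coe_coe, zsmulAddGroupHom_apply, zsmulAddGroupHom_apply, map_zsmul]⟩
  · rintro ⟨y, rfl⟩
    exact ⟨(2 : ℤ) • (oneEquiv R).symm y, two_zsmul_mem_twoMultiples R 1 _, by
      rw [AddMonoidHom.coe_coe, map_zsmul, AddEquiv.apply_symm_apply, zsmulAddGroupHom_apply]⟩

variable (R) in
/-- **`k₁R ≅ R•/R•²`** — the units written additively modulo `2`, i.e. modulo squares (`mem_range_two_zsmul_iff`).
[cite: Milnor1970, §3 «with k₁F ≅ F•/F•²» (p0010 L31)] -/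
def kOneEquiv : Mod2 R 1 ≃+ Additive Rˣ ⧸ (zsmulAddGroupHom (α := Additive Rˣ) 2).range :=
  QuotientAddGroup.congr (twoMultiples R 1) _ (oneEquiv R) map_oneEquiv_twoMultiples

/-- `kOneEquiv {a} = [a]`, the square class of `a`. [cite: Milnor1970, §3 «with k₁F ≅ F•/F•²» (p0010 L31)] -/
theorem kOneEquiv_kSymbol (a : Fin 1 → Rˣ) :
    kOneEquiv R (kSymbol a) = QuotientAddGroup.mk (Additive.ofMul (a 0)) := by
  rw [← oneEquiv_symbol]; rfl

end Ring

/-! ### over a field: `k_*F` is commutative, LEMMA 1.2 mod 2, and the rank-2 computation of §3 -/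

section Field

variable {F : Type*} [Field F]

/-- Signs are invisible mod `2`: `(−1)^k z ≡ z`. [cite: Milnor1970, §3 «Thus k_*F is a graded algebra over Z/2Z» (p0010 L30–L31)] -/
theorem kmk_neg_one_pow_zsmul {n : ℕ} (k : ℕ) (z : MilnorK F n) : kmk F n (((-1 : ℤ) ^ k) • z) = kmk F n z := by
  rcases Nat.even_or_odd k with h | h
  · rw [h.neg_one_pow, one_zsmul]
  · rw [h.neg_one_pow, neg_one_zsmul, map_neg, neg_eq_self']

/-- **LEMMA 1.1 mod `2`: `{b, a} = {a, b}` in `k_{m+n}F`** — the sign `(−1)^{mn}` of `ηξ = (−1)^{mn}ξη` dies, up to the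
degree identification `k_{n+m} = k_{m+n}`. [cite: Milnor1970, §1 Lemma 1.1 (p0002 L33–L45); §3 (p0010 L30–L31)] -/
theorem kSymbol_append_comm {m n : ℕ} (a : Fin m → Fˣ) (b : Fin n → Fˣ) :
    kSymbol (Fin.append b a) = kCast (Nat.add_comm m n) (kSymbol (Fin.append a b)) := by
  rw [kSymbol, symbol_append_comm, kmk_neg_one_pow_zsmul, kSymbol, kCast_kmk]

/-- **The graded algebra `k_*F` is commutative**: `ηξ = ξη` for `ξ ∈ k_mF`, `η ∈ k_nF`, up to the degree identification.
[cite: Milnor1970, §1 Lemma 1.1 (p0002 L33–L45); §3 (p0010 L30–L31)] -/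
theorem kMul_comm {m n : ℕ} (x : Mod2 F m) (y : Mod2 F n) :
    kMul F n m y x = kCast (Nat.add_comm m n) (kMul F m n x y) := by
  suffices h : (kMul F n m).flip =
      (AddMonoidHom.compHom (kCast (R := F) (Nat.add_comm m n)).toAddMonoidHom).comp (kMul F m n) from
    DFunLike.congr_fun (DFunLike.congr_fun h x) y
  refine mod2_hom_ext₂ (fun a b => ?_)
  rw [AddMonoidHom.flip_apply, kMul_kSymbol, AddMonoidHom.comp_apply, AddMonoidHom.compHom_apply_apply,
    AddMonoidHom.comp_apply, kMul_kSymbol, AddEquiv.coe_toAddMonoidHom, kSymbol_append_comm]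

/-- **LEMMA 1.2 mod `2`** at two slots: `{…, x, …, x, …} = {…, x, …, −1, …}` in `k_nF`. [cite: Milnor1970, §1 Lemma 1.2 (p0002 L48–L50); §3 (p0010 L27–L31)] -/
theorem kSymbol_eq_update_neg_one_of_eq {m : ℕ} (a : Fin m → Fˣ) {i j : Fin m} (hij : i ≠ j) (heq : a i = a j) :
    kSymbol a = kSymbol (update a j (-1)) := by
  rw [kSymbol, symbol_eq_update_neg_one_of_eq a hij heq, kSymbol]

/-! #### `k₂F`: the symbols `{a, b}` -/

/-- The symbol `{a, b} = l(a)l(b) ∈ k₂F`. [cite: Milnor1970, §3 proof of Lemma 3.1, the rank 2 case (p0011 L33 – p0012 L6)] -/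
def kpair (a b : Fˣ) : Mod2 F 2 := kSymbol ![a, b]

/-- `kpair` unfolded. [cite: Milnor1970, §3 proof of Lemma 3.1, the rank 2 case (p0011 L33 – p0012 L6)] -/
theorem kpair_def (a b : Fˣ) : kpair a b = kSymbol ![a, b] := rfl

/-- `{a₁a₂, b} = {a₁, b} + {a₂, b}` in `k₂F`. [cite: Milnor1970, §3 proof of Lemma 3.1, the rank 2 case (p0011 L33 – p0012 L6)] -/
theorem kpair_mul_left (a₁ a₂ b : Fˣ) : kpair (a₁ * a₂) b = kpair a₁ b + kpair a₂ b := by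
  rw [kpair, kpair, kpair, kSymbol, symbol_vec2_mul_left, map_add]; rfl

/-- `{a, b₁b₂} = {a, b₁} + {a, b₂}` in `k₂F`. [cite: Milnor1970, §3 proof of Lemma 3.1, the rank 2 case (p0011 L33 – p0012 L6)] -/
theorem kpair_mul_right (a b₁ b₂ : Fˣ) : kpair a (b₁ * b₂) = kpair a b₁ + kpair a b₂ := by
  rw [kpair, kpair, kpair, kSymbol, symbol_vec2_mul_right, map_add]; rfl

/-- The Steinberg relation `{a, 1 − a} = 0` in `k₂F` («the equation 1 = a x²/α + b y²/α implies that 0 = …»). [cite: Milnor1970, §3 proof of Lemma 3.1, the rank 2 case (p0011 L33 – p0012 L6)] -/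
theorem kpair_eq_zero_of_add_eq_one (a b : Fˣ) (h : (a : F) + b = 1) : kpair a b = 0 := by
  rw [kpair, kSymbol, symbol_vec2_eq_zero_of_add_eq_one a b h, map_zero]

/-- `{a⁻¹, b} = {a, b}` in `k₂F`. [cite: Milnor1970, §3 proof of Lemma 3.1, the rank 2 case (p0011 L33 – p0012 L6)] -/
theorem kpair_inv_left (a b : Fˣ) : kpair a⁻¹ b = kpair a b := by
  rw [kpair, kpair, ← update_vec2_zero a b a⁻¹, kSymbol_update_inv, update_vec2_zero]

/-- `{a, b⁻¹} = {a, b}` in `k₂F`. [cite: Milnor1970, §3 proof of Lemma 3.1, the rank 2 case (p0011 L33 – p0012 L6)] -/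
theorem kpair_inv_right (a b : Fˣ) : kpair a b⁻¹ = kpair a b := by
  rw [kpair, kpair, ← update_vec2_one a b b⁻¹, kSymbol_update_inv, update_vec2_one]

/-- `{x y², b} = {x, b}` in `k₂F` («l(a) + 2l(x) − l(α) ≡ l(a) − l(α)»). [cite: Milnor1970, §3 proof of Lemma 3.1, the rank 2 case (p0011 L33 – p0012 L6)] -/
theorem kpair_mul_sq_left (x y b : Fˣ) : kpair (x * y ^ 2) b = kpair x b := by
  rw [kpair, kpair, ← update_vec2_zero x b (x * y ^ 2), kSymbol_update_mul_sq, update_vec2_zero]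

/-- `{a, x y²} = {a, x}` in `k₂F`. [cite: Milnor1970, §3 proof of Lemma 3.1, the rank 2 case (p0011 L33 – p0012 L6)] -/
theorem kpair_mul_sq_right (a x y : Fˣ) : kpair a (x * y ^ 2) = kpair a x := by
  rw [kpair, kpair, ← update_vec2_one a x (x * y ^ 2), kSymbol_update_mul_sq, update_vec2_one]

/-- `{y², b} = 0` in `k₂F`. [cite: Milnor1970, §3 proof of Lemma 3.1, the rank 2 case (p0011 L33 – p0012 L6)] -/
theorem kpair_sq_left (y b : Fˣ) : kpair (y ^ 2) b = 0 := by
  rw [kpair, ← update_vec2_zero y b (y ^ 2), kSymbol_update_sq]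

/-- `{a, y²} = 0` in `k₂F`. [cite: Milnor1970, §3 proof of Lemma 3.1, the rank 2 case (p0011 L33 – p0012 L6)] -/
theorem kpair_sq_right (a y : Fˣ) : kpair a (y ^ 2) = 0 := by
  rw [kpair, ← update_vec2_one a y (y ^ 2), kSymbol_update_sq]

/-- Swapping the two entries of a pair. [folklore] -/
private theorem vec2_comp_swap' (a b : Fˣ) : ![a, b] ∘ Equiv.swap (0 : Fin 2) 1 = ![b, a] := by
  funext i
  fin_cases i <;> rfl

/-- **`{b, a} = {a, b}` in `k₂F`** (Lemma 1.1 mod `2`). [cite: Milnor1970, §1 Lemma 1.1 (p0002 L33–L45); §3 (p0010 L30–L31)] -/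
theorem kpair_comm (a b : Fˣ) : kpair b a = kpair a b := by
  have h : (0 : Fin 2).val + 1 < 2 := by decide
  have key := symbol_comp_swap ![a, b] 0 h
  rw [show finSucc (0 : Fin 2) h = 1 from rfl, vec2_comp_swap'] at key
  rw [kpair, kpair, kSymbol, key, map_neg, kSymbol, neg_eq_self']

/-- **`{a, a} = {a, −1}` in `k₂F`** (Lemma 1.2). [cite: Milnor1970, §1 Lemma 1.2 (p0002 L48–L50); §3 (p0010 L27–L31)] -/
theorem kpair_self (a : Fˣ) : kpair a a = kpair a (-1) := by
  have h : (0 : Fin 2) ≠ 1 := by decide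
  rw [kpair, kpair, kSymbol_eq_update_neg_one_of_eq ![a, a] h rfl, update_vec2_one]

/-- `{a, −a} = 0` in `k₂F`. [cite: Milnor1970, §1 Lemma 1.2 (p0002 L48–L50); §3 (p0010 L27–L31)] -/
theorem kpair_neg_self (a : Fˣ) : kpair a (-a) = 0 := by
  rw [show -a = a * -1 by rw [mul_neg_one], kpair_mul_right, kpair_self, add_self_eq_zero]

/-! #### LEMMA 3.1, the rank-2 computation -/

/-- **LEMMA 3.1, the rank-`2` computation**: if the unit `α` is represented by the binary form `⟨a⟩ ⊕ ⟨b⟩`,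
`α = a x² + b y²`, then `{a, b} = {α, abα}` in `k₂F` — «the equation 1 = a x²/α + b y²/α implies that
0 = (l(a) − l(α))(l(b) − l(α)) mod 2K₂F. Rearranging terms […] l(a)l(b) ≡ −l(α)(l(a) + l(b) − l(α)) = l(α)l(β)», with
`β = abα` (`≡ ab/α` modulo squares); the cases `x = 0` or `y = 0` «easily disposed of» by the invisibility of squares.  This
is the identity `w₂(⟨a⟩ ⊕ ⟨b⟩) = w₂(⟨α⟩ ⊕ ⟨β⟩)` making the second Stiefel–Whitney invariant well defined. [cite: Milnor1970, §3 proof of Lemma 3.1, the rank 2 case (p0011 L33 – p0012 L6)] -/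
theorem kpair_eq_of_eq_add_sq (a b α : Fˣ) (x y : F) (hα : (α : F) = a * x ^ 2 + b * y ^ 2) :
    kpair a b = kpair α (a * b * α) := by
  by_cases hy : y = 0
  · -- `α = a x²`: «the case x = 0 or y = 0 is easily disposed of»
    subst hy
    have hx : x ≠ 0 := by
      rintro rfl
      rw [zero_pow two_ne_zero, mul_zero, mul_zero, add_zero] at hα
      exact α.ne_zero hα
    obtain ⟨xu, rfl⟩ : ∃ xu : Fˣ, (xu : F) = x := ⟨Units.mk0 x hx, Units.val_mk0 _⟩
    have hαu : α = a * xu ^ 2 :=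
      Units.ext (by rw [hα, zero_pow two_ne_zero, mul_zero, add_zero, Units.val_mul, Units.val_pow_eq_pow_val])
    have hβ : a * b * (a * xu ^ 2) = b * (a * xu) ^ 2 := Units.ext (by push_cast; ring)
    rw [hαu, kpair_mul_sq_left, hβ, kpair_mul_sq_right]
  by_cases hx : x = 0
  · -- `α = b y²`
    subst hx
    obtain ⟨yu, rfl⟩ : ∃ yu : Fˣ, (yu : F) = y := ⟨Units.mk0 y hy, Units.val_mk0 _⟩
    have hαu : α = b * yu ^ 2 :=
      Units.ext (by rw [hα, zero_pow two_ne_zero, mul_zero, zero_add, Units.val_mul, Units.val_pow_eq_pow_val])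
    have hβ : a * b * (b * yu ^ 2) = a * (b * yu) ^ 2 := Units.ext (by push_cast; ring)
    rw [hαu, kpair_mul_sq_left, hβ, kpair_mul_sq_right]
    exact (kpair_comm a b).symm
  · -- «Then the equation 1 = a x²/α + b y²/α implies that 0 = (l(a) − l(α))(l(b) − l(α)) mod 2K₂F»
    obtain ⟨xu, rfl⟩ : ∃ xu : Fˣ, (xu : F) = x := ⟨Units.mk0 x hx, Units.val_mk0 _⟩
    obtain ⟨yu, rfl⟩ : ∃ yu : Fˣ, (yu : F) = y := ⟨Units.mk0 y hy, Units.val_mk0 _⟩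
    have hsum : ((a * xu ^ 2 * α⁻¹ : Fˣ) : F) + ((b * yu ^ 2 * α⁻¹ : Fˣ) : F) = 1 := by
      simp only [Units.val_mul, Units.val_pow_eq_pow_val, Units.val_inv_eq_inv_val]
      rw [← add_mul, ← hα, mul_inv_cancel₀ α.ne_zero]
    have h0 := kpair_eq_zero_of_add_eq_one _ _ hsum
    have hexp : kpair (a * xu ^ 2 * α⁻¹) (b * yu ^ 2 * α⁻¹) = kpair a b + (kpair a α + kpair α b + kpair α α) := by
      simp only [kpair_mul_left, kpair_mul_right, kpair_sq_left, kpair_sq_right, kpair_inv_left, kpair_inv_right,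
        add_zero]
      abel
    rw [hexp] at h0
    -- «Rearranging terms»: `l(a)l(b) = l(α)(l(a) + l(b) + l(α)) = l(α)l(abα)`
    have h2 : kpair a b = kpair a α + kpair α b + kpair α α := by
      rw [← neg_eq_self' (kpair a α + kpair α b + kpair α α)]
      exact eq_neg_of_add_eq_zero_left h0
    rw [h2, kpair_mul_right, kpair_mul_right, kpair_comm α a]

/-- `{ab} = {a} + {b}` in `k₁R`. [cite: Milnor1970, §3 «with k₁F ≅ F•/F•²» (p0010 L31)] -/
theorem kSymbol_const_mul (a b : Fˣ) :
    kSymbol (fun _ : Fin 1 => a * b) = kSymbol (fun _ : Fin 1 => a) + kSymbol (fun _ : Fin 1 => b) := by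
  have := kSymbol_update_mul (fun _ : Fin 1 => (1 : Fˣ)) 0 a b
  simp only [update_eq_const_of_subsingleton] at this
  exact this

/-- The rank-`2` computation in degree `1`, «(4) l(a) + l(b) ≡ l(α) + l(β) mod 2K₁F» with `β = abα`: the first
Stiefel–Whitney invariants (discriminants) of `⟨a⟩ ⊕ ⟨b⟩` and `⟨α⟩ ⊕ ⟨abα⟩` agree. [cite: Milnor1970, §3 proof of Lemma 3.1, the rank 2 case (p0011 L33 – p0012 L6)] -/
theorem kSymbol_add_eq_of_eq_add_sq (a b α : Fˣ) :
    kSymbol (fun _ : Fin 1 => a) + kSymbol (fun _ : Fin 1 => b) =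
      kSymbol (fun _ : Fin 1 => α) + kSymbol (fun _ : Fin 1 => a * b * α) := by
  rw [kSymbol_const_mul, kSymbol_const_mul]
  symm
  calc kSymbol (fun _ : Fin 1 => α) + (kSymbol (fun _ : Fin 1 => a) + kSymbol (fun _ : Fin 1 => b) +
        kSymbol (fun _ : Fin 1 => α))
      = kSymbol (fun _ : Fin 1 => a) + kSymbol (fun _ : Fin 1 => b) +
        (kSymbol (fun _ : Fin 1 => α) + kSymbol (fun _ : Fin 1 => α)) := by abel
    _ = kSymbol (fun _ : Fin 1 => a) + kSymbol (fun _ : Fin 1 => b) := by rw [add_self_eq_zero, add_zero]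

end Field

end MilnorK

end Literature.RingTheory.KTheory

end
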